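import Literature.AlgebraicGeometry.GroupSchemes.IdempotentSplittingFiniteFlat
import Literature.AlgebraicGeometry.GroupSchemes.BarsottiTateGroupHom
import HarnessLib

/-!
# The fixed part `Fix ε ⊆ B` of an idempotent endomorphism of a Barsotti–Tate group is a Barsotti–Tate group

Topic `Literature/AlgebraicGeometry/GroupSchemes`; namespace `Literature.AlgebraicGeometry.GroupSchemes.BTGroup.Hom`.  Cell
`hodgecm-mathlib` (D-0151), FLOOR 0, P6 «MOD programme», organ of the P6b line's `stub_L42_idempotentSplitting` («an idempotent
endomorphism of a Barsotti–Tate group splits off a Barsotti–Tate group», the group-scheme half of `A[p^∞] = ∏_{w ∣ p} A[w^∞]`,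
[RapoportSmithlingZhang2020Diagonal] §4.1 «(dec pdiv)»), σ2 «kernel of `1 − ε`»; over ★ `GroupSchemes/IdempotentSplittingFiniteFlat`
(`Fix ε = Ker(𝟙 ∕ ε)`, its group structure, retraction, `fixMap`), ★ `GroupSchemes/BarsottiTateGroup{,Hom}` (Tate's carrier `BTGroup`,
`BTGroup.Hom`) and ★ `Morphisms/FlatOfRetract`.  `--supports stmt-HodgeConjecture-24832`; COUNT-NEUTRAL: HC_CM is proved only modulo the
7 printed citations until rung 0 closes; this file discharges none of them.  Four `abbrev`s (`fixLayer`, `fixLayerι`, `fixIncl`,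
`fixPMap`), one reducible `def` (`fixLayerGrpObj`), two `def`s (`fixBTGroup`, `fixBTGroupι`) + theorems; no named fact, no instance, no
notation, no `sorry`.

THE PRINT.  [Tate1967] §2 (2.1): a `p`-divisible group is a tower `(G_ν, i_ν)` of finite flat group schemes of order `p^{νh}` with
`i_ν : G_ν ≅ G_{ν+1}[p^ν]`; (2.2)ff.: `p`-divisible groups form an additive category in which the idempotents coming from a ring
action (`𝒪_F ⊗ ℤ_p = ∏_w 𝒪_{F,w}` on `A[p^∞]`, [RapoportSmithlingZhang2020Diagonal] §4.1 p. 17) split.  For an idempotent endomorphism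
`ε = (ε_n)_n` of `B` the layers `Fix ε_n ⊆ G_n` ([GortzWedhorn2020] Def. 4.45 (2): kernels ∕ fixed subgroup schemes) with the
restricted transitions satisfy EVERY axiom of Tate's definition except possibly the order count, which is a separate statement about
ranks (sibling `BarsottiTateGroupFixedPartHeight`): this file proves the axioms and ASSEMBLES the Barsotti–Tate group `Fix ε` from any
rank function `rk_s Fix ε_n = p^{n h₁}`.

WHAT IS HERE (`B : BTGroup S p h`, `ε : BTGroup.Hom B B`, idempotency `hε : ∀ n, ε.app n ≫ ε.app n = ε.app n` where needed):
* §1 the layers **`fixLayer ε n := Fix (ε.app n)`** with group structure `fixLayerGrpObj`, inclusion `fixLayerι` (closed immersion,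
  homomorphism, `ι ≫ ε_n = ι`, universal property `existsUnique_comp_fixLayerι_eq`), `isFinite_fixLayer_hom`, `flat_fixLayer_hom`,
  **`fixLayer_killed`** (`[p^n] = 0`), the transitions **`fixIncl`** (closed immersion, homomorphism) and **`fixPMap`** (homomorphism)
  induced by `incl` ∕ `pMap` (★ `fixMap`), `fixPMap_incl : pMap ≫ incl = [p]`;
* §2 **`isPullback_fixIncl`** — `Fix ε_n = (Fix ε_{n+1})[p^n]` (cartesian square against the unit); **`flat_fixPMap_left`,
  `surjective_fixPMap_left`** — the restricted `[p]`-map `Fix ε_{n+1} → Fix ε_n` is flat and surjective: `Fix ε_{n+1}` is a RETRACT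
  OVER `Fix ε_n` of `P := G_{n+1} ×_{G_n} Fix ε_n` (section `(ι, pMap)`, retraction `pr₁ ≫ ε_{n+1}`), and `P → Fix ε_n` is a base
  change of the flat surjective `pMap` (★ `Morphisms.flat_of_retract`); `isFinite_fixPMap_left`;
* §3 **`fixBTGroup ε hε h₁ hrank : BTGroup S p h₁`** — the assembly from a rank function `hrank : ∀ n s, rk_s (Fix ε_n) = p^{n h₁}`,
  and the inclusion **`fixBTGroupι : BTGroup.Hom (fixBTGroup …) B`** (layers `fixLayerι`).

NOT HERE: the rank function itself (`∃ h₁, rk_s Fix ε_n = p^{n h₁}` over a local base, `p` prime) — sibling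
`GroupSchemes/BarsottiTateGroupFixedPartHeight.lean`.

## References
* [Tate1967] J. T. Tate, *p-divisible groups*, Proc. Conf. Local Fields (Driebergen 1966), Springer 1967 — §2, (2.1)–(2.2).
* [GortzWedhorn2020] U. Görtz, T. Wedhorn, *Algebraic Geometry I*, 2nd ed. (2020) — (4.15) Definition 4.45 (2) (p. 117).
* [RapoportSmithlingZhang2020Diagonal] M. Rapoport, B. Smithling, W. Zhang, *Arithmetic diagonal cycles on unitary Shimura varieties*,
  Compos. Math. 156 (2020) — §4.1 (p. 17), «(dec pdiv)».
* [AtiyahMacdonald1969] M. F. Atiyah, I. G. Macdonald, *Introduction to Commutative Algebra* (1969) — Ch. 2 Exercise 4 (p. 31).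
-/

noncomputable section

universe u

open CategoryTheory CategoryTheory.Limits AlgebraicGeometry MonoidalCategory CartesianMonoidalCategory
open scoped MonObj

namespace Literature.AlgebraicGeometry.GroupSchemes

namespace BTGroup

namespace Hom

variable {S : Scheme.{u}} {p h : ℕ} {B : BTGroup S p h} (ε : Hom B B)

/-! ## §1 The fixed layers `Fix (ε_n) ⊆ G_n` and their transitions -/

/-- **The `n`-th layer `Fix ε_n ⊆ G_n` of the fixed part** of an endomorphism `ε` of a Barsotti–Tate group `B`: the fixed
subscheme `Ker(𝟙 ∕ ε_n)` of `ε_n = ε.app n` (★ `IdempotentSplitting.fix`). [cite: GortzWedhorn2020, Definition 4.45 (2), p. 117]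
[cite: Tate1967, §2 (2.1)] -/
abbrev fixLayer (n : ℕ) : Over S :=
  letI := B.grpObj n
  IdempotentSplitting.fix (ε.app n)

/-- The group structure of `Fix ε_n` (a subgroup scheme: `G_n` is commutative and `ε_n` a homomorphism; reducible, bind with `letI`).
[cite: GortzWedhorn2020, Definition 4.45 (2), p. 117] -/
@[reducible] def fixLayerGrpObj (n : ℕ) : GrpObj (ε.fixLayer n) :=
  letI := B.grpObj n
  haveI := B.comm n
  haveI := ε.isMonHom_app n
  IdempotentSplitting.fixGrpObj (ε.app n)

/-- The inclusion `ι_n : Fix ε_n ⟶ G_n`. [cite: GortzWedhorn2020, Definition 4.45 (2), p. 117] -/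
abbrev fixLayerι (n : ℕ) : ε.fixLayer n ⟶ B.G n :=
  letI := B.grpObj n
  IdempotentSplitting.fixι (ε.app n)

/-- `ι_n ≫ ε_n = ι_n`: the points of `Fix ε_n` are fixed. [cite: GortzWedhorn2020, Definition 4.45 (2), p. 117] -/
theorem fixLayerι_comp (n : ℕ) : ε.fixLayerι n ≫ ε.app n = ε.fixLayerι n :=
  letI := B.grpObj n
  IdempotentSplitting.fixι_comp (ε.app n)

/-- `ι_n` is a monomorphism. [cite: GortzWedhorn2020, Definition 4.45 (2), p. 117] -/
theorem mono_fixLayerι (n : ℕ) : Mono (ε.fixLayerι n) :=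
  letI := B.grpObj n
  IdempotentSplitting.mono_fixι (ε.app n)

/-- `ι_n` is a homomorphism. [cite: GortzWedhorn2020, Definition 4.45 (2), p. 117] -/
theorem isMonHom_fixLayerι (n : ℕ) :
    letI := B.grpObj n; letI := ε.fixLayerGrpObj n; IsMonHom (ε.fixLayerι n) :=
  letI := B.grpObj n
  haveI := B.comm n
  haveI := ε.isMonHom_app n
  IdempotentSplitting.isMonHom_fixι (ε.app n)

/-- `Fix ε_n` is commutative. [cite: GortzWedhorn2020, Definition 4.45 (2), p. 117] -/
theorem isCommMonObj_fixLayer (n : ℕ) : letI := ε.fixLayerGrpObj n; IsCommMonObj (ε.fixLayer n) :=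
  letI := B.grpObj n
  haveI := B.comm n
  haveI := ε.isMonHom_app n
  IdempotentSplitting.isCommMonObj_fix (ε.app n)

/-- `ι_n` is a closed immersion on underlying schemes (`G_n → S` is finite, hence separated). [cite: GortzWedhorn2020, Definition 4.45 (2), p. 117] -/
theorem isClosedImmersion_fixLayerι_left (n : ℕ) : IsClosedImmersion (ε.fixLayerι n).left := by
  letI := B.grpObj n
  haveI : IsFinite (B.G n).hom := B.isFinite n
  haveI : IsSeparated (B.G n).hom := inferInstance
  exact IdempotentSplitting.isClosedImmersion_fixι_left (ε.app n)

/-- `Fix ε_n → S` is finite. [cite: Tate1967, §2 (2.1)] -/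
theorem isFinite_fixLayer_hom (n : ℕ) : IsFinite (ε.fixLayer n).hom := by
  letI := B.grpObj n
  haveI : IsFinite (B.G n).hom := B.isFinite n
  exact IdempotentSplitting.isFinite_fix_hom (ε.app n)

/-- `Fix ε_n → S` is flat for IDEMPOTENT `ε` (a retract of the flat `G_n`; ★ `flat_fix_hom`). [cite: AtiyahMacdonald1969, Ch. 2 Exercise 4 (p. 31)] -/
theorem flat_fixLayer_hom (hε : ∀ n, ε.app n ≫ ε.app n = ε.app n) (n : ℕ) : Flat (ε.fixLayer n).hom := by
  letI := B.grpObj n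
  haveI : Flat (B.G n).hom := B.flat n
  exact IdempotentSplitting.flat_fix_hom (ε.app n) (hε n)

/-- **Universal property of `Fix ε_n`**: a `T`-valued point `t` of `G_n` fixed by `ε_n` factors UNIQUELY through `ι_n`.
[cite: GortzWedhorn2020, Definition 4.45 (2), p. 117] -/
theorem existsUnique_comp_fixLayerι_eq (n : ℕ) {T : Over S} (t : T ⟶ B.G n) (ht : t ≫ ε.app n = t) :
    ∃! s : T ⟶ ε.fixLayer n, s ≫ ε.fixLayerι n = t := by
  letI := B.grpObj n
  haveI := ε.mono_fixLayerι n
  refine ⟨IdempotentSplitting.fixLift (ε.app n) t ht, IdempotentSplitting.fixLift_ι _ _ _, fun s hs => ?_⟩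
  rw [← cancel_mono (ε.fixLayerι n), hs]
  exact (IdempotentSplitting.fixLift_ι _ _ _).symm

/-- **`Fix ε_n` is killed by `p^n`** (`ι_n` is a monomorphic homomorphism and `G_n` is killed by `p^n`). [cite: Tate1967, §2 (2.1)] -/
theorem fixLayer_killed (n : ℕ) :
    letI := ε.fixLayerGrpObj n; (𝟙 (ε.fixLayer n) : ε.fixLayer n ⟶ ε.fixLayer n) ^ (p ^ n) = 1 := by
  letI := B.grpObj n
  haveI := B.comm n
  haveI := ε.isMonHom_app n
  letI := ε.fixLayerGrpObj n
  haveI := ε.isMonHom_fixLayerι n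
  haveI := ε.mono_fixLayerι n
  rw [← cancel_mono (ε.fixLayerι n), MonObj.pow_comp, Category.id_comp, MonObj.one_comp]
  calc (ε.fixLayerι n) ^ (p ^ n) = ε.fixLayerι n ≫ (𝟙 (B.G n)) ^ (p ^ n) := by
        rw [MonObj.comp_pow, Category.comp_id]
    _ = 1 := by rw [B.killed n, MonObj.comp_one]

/-- **The transition `Fix ε_n ⟶ Fix ε_{n+1}`** induced by `incl n` (which commutes with `ε`: `incl ≫ ε_{n+1} = ε_n ≫ incl`, ★ `fixMap`).
[cite: Tate1967, §2 (2.1)] -/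
abbrev fixIncl (n : ℕ) : ε.fixLayer n ⟶ ε.fixLayer (n + 1) :=
  letI := B.grpObj n
  letI := B.grpObj (n + 1)
  IdempotentSplitting.fixMap (ε.app n) (ε.app (n + 1)) (B.incl n) (ε.incl_comp_app n)

/-- `fixIncl n ≫ ι_{n+1} = ι_n ≫ incl n`. [cite: Tate1967, §2 (2.1)] -/
@[reassoc]
theorem fixIncl_ι (n : ℕ) : ε.fixIncl n ≫ ε.fixLayerι (n + 1) = ε.fixLayerι n ≫ B.incl n :=
  letI := B.grpObj n
  letI := B.grpObj (n + 1)
  IdempotentSplitting.fixMap_ι _ _ _ _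

/-- The transition `Fix ε_n ⟶ Fix ε_{n+1}` is a homomorphism. [cite: Tate1967, §2 (2.1)] -/
theorem isMonHom_fixIncl (n : ℕ) :
    letI := ε.fixLayerGrpObj n; letI := ε.fixLayerGrpObj (n + 1); IsMonHom (ε.fixIncl n) := by
  letI := B.grpObj n
  letI := B.grpObj (n + 1)
  haveI := B.comm n
  haveI := B.comm (n + 1)
  haveI := ε.isMonHom_app n
  haveI := ε.isMonHom_app (n + 1)
  haveI := B.incl_isMonHom n
  exact IdempotentSplitting.isMonHom_fixMap _ _ _ _

/-- The transition `Fix ε_n ⟶ Fix ε_{n+1}` is a closed immersion. [cite: Tate1967, §2 (2.1)] -/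
theorem isClosedImmersion_fixIncl_left (n : ℕ) : IsClosedImmersion (ε.fixIncl n).left := by
  letI := B.grpObj n
  letI := B.grpObj (n + 1)
  haveI : IsFinite (B.G (n + 1)).hom := B.isFinite (n + 1)
  haveI : IsSeparated (B.G (n + 1)).hom := inferInstance
  haveI := B.isClosedImmersion_incl n
  exact IdempotentSplitting.isClosedImmersion_fixMap_left _ _ _ _

/-- **The restricted `[p]`-map `Fix ε_{n+1} ⟶ Fix ε_n`** induced by `pMap n` (`pMap ≫ ε_n = ε_{n+1} ≫ pMap`, ★ `pMap_comp_app`).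
[cite: Tate1967, §2 (2.1)] -/
abbrev fixPMap (n : ℕ) : ε.fixLayer (n + 1) ⟶ ε.fixLayer n :=
  letI := B.grpObj n
  letI := B.grpObj (n + 1)
  IdempotentSplitting.fixMap (ε.app (n + 1)) (ε.app n) (B.pMap n) (ε.pMap_comp_app n)

/-- `fixPMap n ≫ ι_n = ι_{n+1} ≫ pMap n`. [cite: Tate1967, §2 (2.1)] -/
@[reassoc]
theorem fixPMap_ι (n : ℕ) : ε.fixPMap n ≫ ε.fixLayerι n = ε.fixLayerι (n + 1) ≫ B.pMap n :=
  letI := B.grpObj n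
  letI := B.grpObj (n + 1)
  IdempotentSplitting.fixMap_ι _ _ _ _

/-- The restricted `[p]`-map is a homomorphism. [cite: Tate1967, §2 (2.1)] -/
theorem isMonHom_fixPMap (n : ℕ) :
    letI := ε.fixLayerGrpObj n; letI := ε.fixLayerGrpObj (n + 1); IsMonHom (ε.fixPMap n) := by
  letI := B.grpObj n
  letI := B.grpObj (n + 1)
  haveI := B.comm n
  haveI := B.comm (n + 1)
  haveI := ε.isMonHom_app n
  haveI := ε.isMonHom_app (n + 1)
  haveI := B.pMap_isMonHom n
  exact IdempotentSplitting.isMonHom_fixMap _ _ _ _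

/-- `fixPMap n ≫ fixIncl n = [p]` on `Fix ε_{n+1}`. [cite: Tate1967, §2 (2.1)] -/
theorem fixPMap_incl (n : ℕ) :
    letI := ε.fixLayerGrpObj (n + 1)
    ε.fixPMap n ≫ ε.fixIncl n = (𝟙 (ε.fixLayer (n + 1)) : ε.fixLayer (n + 1) ⟶ ε.fixLayer (n + 1)) ^ p := by
  letI := B.grpObj n
  letI := B.grpObj (n + 1)
  haveI := B.comm (n + 1)
  haveI := ε.isMonHom_app (n + 1)
  letI := ε.fixLayerGrpObj (n + 1)
  haveI := ε.isMonHom_fixLayerι (n + 1)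
  haveI := ε.mono_fixLayerι (n + 1)
  rw [← cancel_mono (ε.fixLayerι (n + 1)), Category.assoc, fixIncl_ι, fixPMap_ι_assoc, B.pMap_incl n,
    MonObj.pow_comp, Category.id_comp, MonObj.comp_pow, Category.comp_id]

/-! ## §2 `Fix ε_n` is the kernel of `p^n` on `Fix ε_{n+1}`; the restricted `p`-map is flat and surjective -/

/-- **`Fix ε_n` IS THE KERNEL OF `[p^n]` ON `Fix ε_{n+1}`**: the square `Fix ε_n →(fixIncl) Fix ε_{n+1} →([p^n]) Fix ε_{n+1} ←(e) S`
is cartesian (a point of `Fix ε_{n+1}` killed by `p^n` lies in `G_n = G_{n+1}[p^n]` and is still `ε`-fixed, `incl` being a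
monomorphism compatible with `ε`). [cite: Tate1967, §2 (2.1)] -/
theorem isPullback_fixIncl (n : ℕ) :
    letI := ε.fixLayerGrpObj (n + 1)
    IsPullback (ε.fixIncl n) (toUnit (ε.fixLayer n))
      ((𝟙 (ε.fixLayer (n + 1)) : ε.fixLayer (n + 1) ⟶ ε.fixLayer (n + 1)) ^ (p ^ n)) η[ε.fixLayer (n + 1)] := by
  letI := B.grpObj n
  letI := B.grpObj (n + 1)
  haveI := B.comm n
  haveI := B.comm (n + 1)
  haveI := ε.isMonHom_app n
  haveI := ε.isMonHom_app (n + 1)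
  letI := ε.fixLayerGrpObj n
  letI := ε.fixLayerGrpObj (n + 1)
  haveI := ε.isMonHom_fixLayerι n
  haveI := ε.isMonHom_fixLayerι (n + 1)
  haveI := ε.mono_fixLayerι n
  haveI := ε.mono_fixLayerι (n + 1)
  haveI := B.mono_incl n
  haveI := B.incl_isMonHom n
  -- `[p^n]` after the monomorphism `ι_{n+1}`
  have hpow : ∀ {W : Over S} (w : W ⟶ ε.fixLayer (n + 1)),
      (w ≫ (𝟙 (ε.fixLayer (n + 1))) ^ (p ^ n)) ≫ ε.fixLayerι (n + 1) =
        (w ≫ ε.fixLayerι (n + 1)) ≫ (𝟙 (B.G (n + 1))) ^ (p ^ n) := fun w => by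
    rw [MonObj.comp_pow, Category.comp_id, MonObj.pow_comp, MonObj.comp_pow, Category.comp_id]
  -- the square commutes
  have hw : ε.fixIncl n ≫ (𝟙 (ε.fixLayer (n + 1))) ^ (p ^ n) = toUnit _ ≫ η[ε.fixLayer (n + 1)] := by
    rw [← cancel_mono (ε.fixLayerι (n + 1)), hpow, fixIncl_ι, Category.assoc, (B.isPullback_incl n).w,
      Category.assoc, IsMonHom.one_hom, ← Category.assoc, toUnit_unique (ε.fixLayerι n ≫ toUnit _) (toUnit _)]
  refine IsPullback.of_isLimit' ⟨hw⟩ (PullbackCone.IsLimit.mk _ (fun c => ?_) (fun c => ?_) (fun c => ?_)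
    (fun c m hm _ => ?_))
  · -- the lift: `c.fst ≫ ι_{n+1}` is killed by `p^n`, so factors through `G_n`, through an `ε_n`-fixed point
    have hkill : (c.fst ≫ ε.fixLayerι (n + 1)) ≫ (𝟙 (B.G (n + 1))) ^ (p ^ n) = toUnit _ ≫ η[B.G (n + 1)] := by
      rw [← hpow, c.condition, Category.assoc, IsMonHom.one_hom, toUnit_unique c.snd (toUnit _)]
    refine IdempotentSplitting.fixLift (ε.app n) ((B.isPullback_incl n).lift _ _ hkill) ?_
    rw [← cancel_mono (B.incl n), Category.assoc, ← ε.incl_comp_app n, IsPullback.lift_fst_assoc, Category.assoc,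
      fixLayerι_comp, IsPullback.lift_fst]
  · rw [← cancel_mono (ε.fixLayerι (n + 1)), Category.assoc, fixIncl_ι, IdempotentSplitting.fixLift_ι_assoc,
      IsPullback.lift_fst]
  · exact toUnit_unique _ _
  · rw [← cancel_mono (ε.fixLayerι n), ← cancel_mono (B.incl n), Category.assoc, Category.assoc,
      IdempotentSplitting.fixLift_ι_assoc, IsPullback.lift_fst, ← fixIncl_ι, ← Category.assoc, hm]

/-- **THE RESTRICTED `[p]`-MAP `Fix ε_{n+1} → Fix ε_n` IS FLAT**: `Fix ε_{n+1}` is a retract, over `Fix ε_n`, of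
`P := G_{n+1} ×_{G_n} Fix ε_n` — section `(ι_{n+1}, fixPMap)`, retraction `pr₁ ≫ ε_{n+1}` (which lies over `Fix ε_n` because `ε`
commutes with `pMap` and fixes `Fix ε_n`) — and `P → Fix ε_n`, a base change of `pMap`, is flat (★ `Morphisms.flat_of_retract`).
[cite: AtiyahMacdonald1969, Ch. 2 Exercise 4 (p. 31)] [cite: Tate1967, §2 (2.1)] -/
theorem flat_fixPMap_left (hε : ∀ n, ε.app n ≫ ε.app n = ε.app n) (n : ℕ) : Flat (ε.fixPMap n).left := by
  letI := B.grpObj n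
  letI := B.grpObj (n + 1)
  haveI : Flat (B.pMap n).left := B.flat_pMap n
  -- `P → Fix ε_n`, the base change of the flat `pMap`
  let π := (B.pMap n).left
  let j := (ε.fixLayerι n).left
  haveI : Flat (pullback.snd π j) := MorphismProperty.pullback_snd _ _ inferInstance
  -- the section `Fix ε_{n+1} → P` and the retraction `P → G_{n+1} → Fix ε_{n+1}`
  have hsq : (ε.fixLayerι (n + 1)).left ≫ π = (ε.fixPMap n).left ≫ j := by
    rw [← Over.comp_left, ← Over.comp_left, fixPMap_ι]
  refine Morphisms.flat_of_retract (ε.fixPMap n).left (pullback.snd π j) (pullback.lift _ _ hsq)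
    (pullback.fst π j ≫ (IdempotentSplitting.fixRetract (ε.app (n + 1)) (hε (n + 1))).left) ?_ ?_
  · rw [Category.assoc, ← Over.comp_left, IdempotentSplitting.fixRetract_comp_fixMap _ _ _ (hε (n + 1)) (hε n),
      Over.comp_left, pullback.condition_assoc, ← Over.comp_left, IdempotentSplitting.fixι_fixRetract, Over.id_left,
      Category.comp_id]
  · rw [pullback.lift_fst_assoc, ← Over.comp_left, IdempotentSplitting.fixι_fixRetract, Over.id_left]

/-- **THE RESTRICTED `[p]`-MAP IS SURJECTIVE** (the retraction `P → Fix ε_{n+1}` composed with it is the surjective base change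
`P → Fix ε_n` of `pMap`). [cite: Tate1967, §2 (2.1)] -/
theorem surjective_fixPMap_left (hε : ∀ n, ε.app n ≫ ε.app n = ε.app n) (n : ℕ) : Surjective (ε.fixPMap n).left := by
  letI := B.grpObj n
  letI := B.grpObj (n + 1)
  haveI : Surjective (B.pMap n).left := B.surjective_pMap n
  let π := (B.pMap n).left
  let j := (ε.fixLayerι n).left
  have hs : Surjective (pullback.snd π j) := MorphismProperty.pullback_snd _ _ inferInstance
  have hr : (pullback.fst π j ≫ (IdempotentSplitting.fixRetract (ε.app (n + 1)) (hε (n + 1))).left) ≫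
      (ε.fixPMap n).left = pullback.snd π j := by
    rw [Category.assoc, ← Over.comp_left, IdempotentSplitting.fixRetract_comp_fixMap _ _ _ (hε (n + 1)) (hε n),
      Over.comp_left, pullback.condition_assoc, ← Over.comp_left, IdempotentSplitting.fixι_fixRetract, Over.id_left,
      Category.comp_id]
  refine ⟨Function.Surjective.of_comp (g := (pullback.fst π j ≫
    (IdempotentSplitting.fixRetract (ε.app (n + 1)) (hε (n + 1))).left)) ?_⟩
  have hfun : (⇑(ε.fixPMap n).left ∘ ⇑(pullback.fst π j ≫
      (IdempotentSplitting.fixRetract (ε.app (n + 1)) (hε (n + 1))).left)) = ⇑(pullback.snd π j) := by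
    rw [← hr]
    exact funext fun x => (Scheme.Hom.comp_apply _ _ x).symm
  rw [hfun]
  exact hs.surj

/-- The restricted `[p]`-map is finite (a morphism of finite `S`-schemes). [cite: Tate1967, §2 (2.1)] -/
theorem isFinite_fixPMap_left (n : ℕ) : IsFinite (ε.fixPMap n).left := by
  haveI : IsFinite (ε.fixLayer n).hom := ε.isFinite_fixLayer_hom n
  haveI : IsFinite ((ε.fixPMap n).left ≫ (ε.fixLayer n).hom) := by
    rw [Over.w]; exact ε.isFinite_fixLayer_hom (n + 1)
  exact IsFinite.of_comp _ (ε.fixLayer n).hom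

/-! ## §3 The Barsotti–Tate group `Fix ε` (given its rank function) and the inclusion `Fix ε → B` -/

/-- **THE BARSOTTI–TATE GROUP `Fix ε`** split off by an idempotent endomorphism `ε` of `B`, ASSEMBLED from a rank function
`rk_s (Fix ε_n) = p^{n h₁}` (supplied over a local base by the sibling `BarsottiTateGroupFixedPartHeight`): layers `Fix ε_n`,
transitions and `[p]`-maps restricted from `B`; all of Tate's axioms (§1–§2). [cite: Tate1967, §2 (2.1)]
[cite: RapoportSmithlingZhang2020Diagonal, §4.1 (p. 17)] -/
def fixBTGroup (hε : ∀ n, ε.app n ≫ ε.app n = ε.app n) (h₁ : ℕ)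
    (hrank : ∀ n (s : S), (ε.fixLayer n).hom.finrank s = p ^ (n * h₁)) : BTGroup S p h₁ where
  G := ε.fixLayer
  grpObj := ε.fixLayerGrpObj
  comm := ε.isCommMonObj_fixLayer
  isFinite := ε.isFinite_fixLayer_hom
  flat := ε.flat_fixLayer_hom hε
  finrank_eq := hrank
  killed := ε.fixLayer_killed
  incl := ε.fixIncl
  incl_isMonHom := ε.isMonHom_fixIncl
  isClosedImmersion_incl := ε.isClosedImmersion_fixIncl_left
  isPullback_incl := ε.isPullback_fixIncl
  pMap := ε.fixPMap
  pMap_incl := ε.fixPMap_incl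
  pMap_isMonHom := ε.isMonHom_fixPMap
  flat_pMap := ε.flat_fixPMap_left hε
  surjective_pMap := ε.surjective_fixPMap_left hε

/-- **The inclusion `Fix ε ⟶ B`** as a homomorphism of Barsotti–Tate groups (layers `ι_n`, compatible with the transitions).
[cite: Tate1967, §2 (2.1)] -/
def fixBTGroupι (hε : ∀ n, ε.app n ≫ ε.app n = ε.app n) (h₁ : ℕ)
    (hrank : ∀ n (s : S), (ε.fixLayer n).hom.finrank s = p ^ (n * h₁)) : Hom (ε.fixBTGroup hε h₁ hrank) B where
  app := ε.fixLayerι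
  isMonHom_app := ε.isMonHom_fixLayerι
  incl_comp_app := ε.fixIncl_ι

/-- Unfolding: the layers of `Fix ε` are the `Fix ε_n`. [cite: Tate1967, §2 (2.1)] -/
@[simp] theorem fixBTGroup_G (hε : ∀ n, ε.app n ≫ ε.app n = ε.app n) (h₁ : ℕ)
    (hrank : ∀ n (s : S), (ε.fixLayer n).hom.finrank s = p ^ (n * h₁)) (n : ℕ) :
    (ε.fixBTGroup hε h₁ hrank).G n = ε.fixLayer n := rfl

/-- Unfolding: the layers of the inclusion `Fix ε ⟶ B` are the `ι_n`. [cite: Tate1967, §2 (2.1)] -/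
@[simp] theorem fixBTGroupι_app (hε : ∀ n, ε.app n ≫ ε.app n = ε.app n) (h₁ : ℕ)
    (hrank : ∀ n (s : S), (ε.fixLayer n).hom.finrank s = p ^ (n * h₁)) (n : ℕ) :
    (ε.fixBTGroupι hε h₁ hrank).app n = ε.fixLayerι n := rfl


end Hom

end BTGroup

end Literature.AlgebraicGeometry.GroupSchemes

end
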